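import Summits.BirchSwinnertonDyer.BirchSwinnertonDyer.Theorems.GenusKolyvaginAtTwoPowDvdShaCardAtTwoRTInvariantLostBit
import HarnessLib

/-!
# Route `GenusKolyvaginAtTwo`, crux U_T `ShaCardDvdPowAtTwoRT` (stmt-BirchSwinnertonDyer-23298; upper half
# `#Ш(E/K)[2^∞] ∣ 2^(2M₀)`) — THE INVISIBLE BOTTOM LAYER: in a `τ`-invariant pairing on a free rank-one `ℤ/2^M[τ]`-module,
# a `τ`-FIXED `2`-TORSION element pairs trivially with EVERY eigenvector (either sign, any order)

Seat `bsd-line-gk2-p3` g25 (PROVER seat 3/3, cell `bsd-f1-sign2`), `--supports stmt-BirchSwinnertonDyer-23298` (helper; closes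
nothing).  Mathlib-only algebra over this lineage's `…RTInvariantLostBit` (g23) and LEAD gk2-p1's `…RTEigenNorms`.  THEOREMS ONLY
(no definition, no named fact, no `sorry`).  BSD is NOT proved by any of this; neither is U_T nor any stub.

WHY (the seat's U_T memo `Cruxes/ShaCardDvdPowAtTwoRT/Lines/norm-sharp-upper-gk2p3.md`, §3).  McCallum's proof of the UPPER half of
Kolyvagin's structure theorem (Thm. 5.4: `N_{k+1} ≤ M_k − M_{k+1}`; also Thm. 5.8) certifies the order of a Kolyvagin class in `Ш(E/K)`
by a non-zero Cassels–Tate value, computed (Prop. 4.7) as a sum of local Tate pairings `⟨loc_λ c, d(n)_λ⟩_λ` at the inert Kolyvagin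
places `λ ∣ n`, each between the UNRAMIFIED localisation of a Selmer lift `c` of the test element of `Ш` — an element of the Kummer
condition `𝓛_λ ≅ E[2^M]`, a free rank-one `ℤ/2^M[τ]`-module on the habitat `Δ < 0` (route item Q1) — and the singular part `d(n)_λ`
of the Kolyvagin class, a `τ`-EIGEN class (Gross Prop. 5.4).  The local Tate pairing is `τ`-invariant (`isConjCompatible_canonical`).
This file isolates the algebraic reason why, at `p = 2`, NO such certificate ever sees the bottom bit of a test element that comes
from `ℚ`: the localisation of a `τ`-invariant `2`-torsion class is a `τ`-fixed `2`-torsion element of `𝓛_λ`, i.e. (free rank one)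
the element `2^(M−1)·(a₀ + τa₀) = NORM(2^(M−1)·a₀)`, and a norm pairs with a `σ`-fixed `y` to `2·(…)·2^(M−1) = 2^M·(…) = 0` and with a
`σ`-anti-fixed `y` to `0` (opposite signs).  Equivalently (restriction `ℚ_ℓ → K_λ` doubles local invariants): the `K`-frame of
Kolyvagin's descent — McCallum verbatim, either sign, every level, with or without the norm-sharp bookkeeping of
`…ShaCardDvdPowAtTwoRTNormSharpPairing` — cannot certify the bottom layer `{β ∈ Ш(E/K)[2]^τ : β lifts to a τ-invariant Selmer class}`,
which on the route's habitat contains the image of `Ш(E/ℚ)[2]` (BSD-predicted non-zero on every WALL-row-1 cell, `16 ∣ Ш_an`).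

* §1 `eq_two_pow_pred_zsmul_norm_of_two_smul_eq_zero_of_fixed` — in `A` free of rank one over `ℤ/2^M[τ]` on `a₀` (`M ≥ 1`): a `τ`-fixed
  `x` with `2 • x = 0` is `a • 2^(M−1) • (a₀ + τa₀)` for some `a : ℤ`; `exists_eq_norm_of_two_smul_eq_zero_of_fixed` — such `x` is a
  norm `u + τu`.
* §2 **`pairing_eq_zero_of_two_smul_eq_zero_of_fixed`** — for `P : A × B → R` with `P(τa, σb) = P(a, b)`: `2 • x = 0`, `τx = x`,
  `σy = ±y` ⟹ `P(x, y) = 0`; the symmetric statement `pairing_eq_zero_of_two_smul_eq_zero_of_antifixed` (`τx = −x`: `x` is a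
  conorm; pairs trivially with every eigen `y`).  NO order hypothesis on `y`.
* §3 `pairing_norm_eq_zero_of_two_pow_pred_smul` — the same one level up: `P(2^(M−1) • (u + τu), y) = 0` for every `u` and every
  eigen `y` (the bottom bit of ANY norm is invisible); contrast: against a NON-eigen `y` the value `P(x, y) = 2^(M−1)·P(a₀, y + σy)` of a
  fixed `2`-torsion `x ≠ 0` can be non-zero (`pairing_two_torsion_fixed_eq`), so the blindness is a property of EIGEN certificates.

References: [McCallumLMS1991] §4 Prop. 4.7, §5 Lemma 5.3, Thm. 5.4 (16)–(23), Thm. 5.8; [GrossLMS1991] Prop. 5.4, §8 Prop. 8.1–8.2;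
[Kolyvagin1991MathAnn] Thm. 2.1; [MilneADT2006] I Cor. 2.3 (restriction multiplies invariants by the local degree).
-/

set_option autoImplicit false
-- `Summit.<P>.<Sub>` repeats `BirchSwinnertonDyer` by the tree's layout convention (D-0017)
set_option linter.dupNamespace false

namespace Summit.BirchSwinnertonDyer.BirchSwinnertonDyer.Theorems.GenusExact.PlusDescent

section Invisible

variable {A B R : Type*} [AddCommGroup A] [AddCommGroup B] [AddCommGroup R]
  (τ : A →+ A) (hτ : ∀ x, τ (τ x) = x) (σ : B →+ B) (hσ : ∀ y, σ (σ y) = y)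
  (P : A →+ B →+ R) (hinv : ∀ x y, P (τ x) (σ y) = P x y)
  {M : ℕ} (a₀ : A)
  (hspan : ∀ Q : A, ∃ a b : ℤ, Q = a • a₀ + b • τ a₀)
  (hfree : ∀ a b : ℤ, a • a₀ + b • τ a₀ = 0 → (2 ^ M : ℤ) ∣ a ∧ (2 ^ M : ℤ) ∣ b)
  (htor : (2 ^ M : ℤ) • a₀ = 0)

/-! ## §1 Fixed `2`-torsion elements are bottom norms -/

include hτ hspan hfree htor in
/-- **A `τ`-fixed `2`-torsion element is a multiple of the bottom norm.**  In `A` free of rank one over `ℤ/2^M[τ]` on `a₀`, `M ≥ 1`: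
if `τx = x` and `2 • x = 0` then `x = a • 2^(M−1) • (a₀ + τa₀)` for some `a : ℤ` (indeed `x = a′ • (a₀ + τa₀)` with `2^M ∣ 2a′`).
[cite: McCallumLMS1991, §5 Lemma 5.3] -/
theorem eq_zsmul_two_pow_pred_norm_of_two_smul_eq_zero_of_fixed (hM : 1 ≤ M) {x : A} (hx : τ x = x) (h2 : (2 : ℤ) • x = 0) :
    ∃ a : ℤ, x = a • ((2 ^ (M - 1) : ℤ) • (a₀ + τ a₀)) := by
  obtain ⟨a', rfl⟩ := exists_eq_zsmul_norm_of_tau_eq τ hτ a₀ hspan hfree htor hx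
  -- `2^M ∣ 2 a'` from `(2 a') • (a₀ + τa₀) = 0` and `addOrderOf (a₀ + τa₀) = 2^M`
  have h0 : (2 * a') • (a₀ + τ a₀) = 0 := by rw [mul_comm, mul_zsmul, ← smul_comm]; simpa using h2
  have hdvd : ((2 ^ M : ℕ) : ℤ) ∣ 2 * a' := by
    rw [← addOrderOf_norm_eq τ a₀ hfree htor]
    exact (addOrderOf_dvd_iff_zsmul_eq_zero).mpr h0
  -- write `2^M = 2 · 2^(M−1)`; then `2^(M−1) ∣ a'`
  obtain ⟨a, ha⟩ : ((2 ^ (M - 1) : ℕ) : ℤ) ∣ a' := by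
    have h2M : ((2 ^ M : ℕ) : ℤ) = 2 * ((2 ^ (M - 1) : ℕ) : ℤ) := by
      obtain ⟨k, hk⟩ := Nat.exists_eq_add_of_le hM
      rw [hk, show 1 + k - 1 = k by omega, pow_add, pow_one]; push_cast; ring
    rw [h2M] at hdvd
    exact (mul_dvd_mul_iff_left two_ne_zero).mp hdvd
  refine ⟨a, ?_⟩
  rw [ha, smul_smul, mul_comm]
  norm_cast

include hτ hspan hfree htor in
/-- **A `τ`-fixed `2`-torsion element is a NORM**: `τx = x`, `2 • x = 0` ⟹ `x = u + τu` for some `u` (namely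
`u = a • 2^(M−1) • a₀`).  At a deep inert Kolyvagin place: the localisation of a `τ`-invariant `2`-torsion Selmer class is the norm
(= restriction from `ℚ_ℓ`) of an unramified class. [cite: McCallumLMS1991, §5 Lemma 5.3] [cite: MilneADT2006, Ch. I Cor. 2.3] -/
theorem exists_eq_norm_of_two_smul_eq_zero_of_fixed (hM : 1 ≤ M) {x : A} (hx : τ x = x) (h2 : (2 : ℤ) • x = 0) :
    ∃ u : A, x = u + τ u := by
  obtain ⟨a, rfl⟩ := eq_zsmul_two_pow_pred_norm_of_two_smul_eq_zero_of_fixed τ hτ a₀ hspan hfree htor hM hx h2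
  exact ⟨a • ((2 ^ (M - 1) : ℤ) • a₀), by rw [map_zsmul, map_zsmul, ← zsmul_add, ← zsmul_add]⟩

/-! ## §2 … and pair trivially with every eigenvector -/

include hσ hinv in
/-- **A norm pairs with a `σ`-fixed `y` to twice a value**: `P(u + τu, y) = 2 • P(u, y)`. [folklore] -/
theorem pairing_norm_of_fixed {y : B} (hy : σ y = y) (u : A) : P (u + τ u) y = 2 • P u y := by
  rw [map_add, AddMonoidHom.add_apply, pairing_tau_left_of_fixed τ σ hσ P hinv hy, two_nsmul]

include hσ hinv in
/-- **A norm pairs trivially with a `σ`-anti-fixed `y`**: `P(u + τu, y) = 0`. [cite: McCallumLMS1991, §5 Lemma 5.3] -/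
theorem pairing_norm_of_antifixed {y : B} (hy : σ y = -y) (u : A) : P (u + τ u) y = 0 := by
  rw [map_add, AddMonoidHom.add_apply, pairing_tau_left_of_antifixed τ σ hσ P hinv hy, add_neg_cancel]

include htor in
/-- `2^(M−1)`-multiples of `a₀` pair into elements killed by `2` (`M ≥ 1`). [folklore] -/
theorem two_smul_pairing_two_pow_pred_zsmul_eq_zero (hM : 1 ≤ M) (a : ℤ) (y : B) :
    (2 : ℕ) • P (a • ((2 ^ (M - 1) : ℤ) • a₀)) y = 0 := by
  have h2M : (2 : ℤ) * (2 ^ (M - 1) : ℤ) = (2 ^ M : ℤ) := by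
    rw [← pow_succ', Nat.sub_add_cancel hM]
  have h : ((2 : ℕ) : ℤ) • (a • ((2 ^ (M - 1) : ℤ) • a₀)) = 0 := by
    rw [smul_smul, smul_smul, show ((2 : ℕ) : ℤ) * a * (2 ^ (M - 1) : ℤ) = a * (2 ^ M : ℤ) by rw [← h2M]; push_cast; ring,
      ← smul_smul, htor, smul_zero]
  rw [← AddMonoidHom.nsmul_apply, ← map_nsmul, ← natCast_zsmul, h, map_zero, AddMonoidHom.zero_apply]

include hτ hσ hinv hspan hfree htor in
/-- **THE INVISIBLE BOTTOM LAYER.**  `P : A × B → R` bi-additive with `P(τa, σb) = P(a, b)`, `A` free of rank one over `ℤ/2^M[τ]`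
on `a₀`, `M ≥ 1`.  If `2 • x = 0` and `τx = x`, then **`P(x, y) = 0` for EVERY `σ`-eigenvector `y`** (`σy = y` or `σy = −y`, of any
order).  (`x` is the norm `u + τu` of `u = a·2^(M−1)·a₀`; against a fixed `y` the value is `2·P(u, y) = a·P(2^M a₀, y) = 0`, against
an anti-fixed `y` it is `0` by opposite signs.)  At `p = 2` on `Δ < 0`: the unramified localisation at an inert Kolyvagin place of a
`τ`-invariant `2`-torsion Selmer class pairs trivially, under the local Tate pairing, with the singular part of EVERY Kolyvagin class
(an eigenclass, Gross Prop. 5.4) — so no Cassels–Tate certificate of McCallum's Thm. 5.4 / 5.8 over `K` detects it.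
[cite: McCallumLMS1991, §4 Prop. 4.7, §5 Lemma 5.3, Thm. 5.4] [cite: GrossLMS1991, Prop. 5.4, §8 Prop. 8.2] -/
theorem pairing_eq_zero_of_two_smul_eq_zero_of_fixed (hM : 1 ≤ M) {x : A} (h2 : (2 : ℤ) • x = 0) (hx : τ x = x)
    {y : B} (hy : σ y = y ∨ σ y = -y) : P x y = 0 := by
  obtain ⟨a, rfl⟩ := eq_zsmul_two_pow_pred_norm_of_two_smul_eq_zero_of_fixed τ hτ a₀ hspan hfree htor hM hx h2
  rcases hy with hy | hy
  · -- fixed `y`: the value is `2 • P(u, y)` with `u = a • 2^(M−1) • a₀`, and `2 • P(u, y) = 0`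
    have hnorm : a • ((2 ^ (M - 1) : ℤ) • (a₀ + τ a₀)) =
        a • ((2 ^ (M - 1) : ℤ) • a₀) + τ (a • ((2 ^ (M - 1) : ℤ) • a₀)) := by
      rw [map_zsmul, map_zsmul, ← zsmul_add, ← zsmul_add]
    rw [hnorm, pairing_norm_of_fixed τ σ hσ P hinv hy]
    exact two_smul_pairing_two_pow_pred_zsmul_eq_zero P a₀ htor hM a y
  · -- anti-fixed `y`: opposite signs
    exact (pairing_eq_zero_of_opposite_signs τ hτ σ hσ P hinv a₀ hspan hfree htor).1 _ y hx hy

include hτ hσ hinv hspan hfree htor in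
/-- **The invisible bottom layer, other sign**: `2 • x = 0`, `τx = −x` ⟹ `P(x, y) = 0` for every `σ`-eigenvector `y`.  (On `2`-torsion
the two signs coincide — `τx = −x = x` when `2x = 0` — so this is the same statement; recorded for callers holding the `−` form.)
[cite: McCallumLMS1991, §5 Lemma 5.3] -/
theorem pairing_eq_zero_of_two_smul_eq_zero_of_antifixed (hM : 1 ≤ M) {x : A} (h2 : (2 : ℤ) • x = 0) (hx : τ x = -x)
    {y : B} (hy : σ y = y ∨ σ y = -y) : P x y = 0 := by
  have hx' : τ x = x := by
    rw [hx, neg_eq_iff_add_eq_zero, ← two_zsmul]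
    exact h2
  exact pairing_eq_zero_of_two_smul_eq_zero_of_fixed τ hτ σ hσ P hinv a₀ hspan hfree htor hM h2 hx' hy

/-! ## §3 One level up, and the contrast with non-eigen test classes -/

include hσ hinv hspan htor in
/-- **The bottom bit of ANY norm is invisible to eigen certificates**: `P(2^(M−1) • (u + τu), y) = 0` for every `u ∈ A` and every
`σ`-eigenvector `y` (`M ≥ 1`).  So a generator of `Ш(E/K)` whose bottom bit is a norm (e.g. any element restricted from `ℚ`) loses
that bit in every `K`-frame certificate, whatever its order. [cite: McCallumLMS1991, §5 Lemma 5.3, Thm. 5.4] -/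
theorem pairing_two_pow_pred_smul_norm_eq_zero (hM : 1 ≤ M) (u : A) {y : B} (hy : σ y = y ∨ σ y = -y) :
    P (((2 ^ (M - 1) : ℕ) : ℤ) • (u + τ u)) y = 0 := by
  rcases hy with hy | hy
  · rw [map_zsmul, AddMonoidHom.zsmul_apply, pairing_norm_of_fixed τ σ hσ P hinv hy, ← natCast_zsmul, smul_smul]
    -- `(2^(M−1) · 2) • P u y = 2^M • P u y = 0`
    have h2M : ((2 ^ (M - 1) : ℕ) : ℤ) * (2 : ℕ) = (2 ^ M : ℤ) := by
      obtain ⟨k, hk⟩ := Nat.exists_eq_add_of_le hM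
      rw [hk, show 1 + k - 1 = k by omega, pow_add, pow_one]; push_cast; ring
    rw [h2M]
    obtain ⟨a, b, rfl⟩ := hspan u
    rw [← AddMonoidHom.zsmul_apply, ← map_zsmul, zsmul_add, smul_smul, smul_smul, mul_comm _ a, mul_comm _ b, ← smul_smul,
      ← smul_smul, ← map_zsmul τ, htor, smul_zero, map_zero, smul_zero, add_zero, map_zero, AddMonoidHom.zero_apply]
  · rw [map_zsmul, AddMonoidHom.zsmul_apply, pairing_norm_of_antifixed τ σ hσ P hinv hy, zsmul_zero]

include hσ hinv in
/-- **Contrast: a NON-eigen test class sees the fixed bottom bit.**  For any `x = u + τu` and any `y`: `P(x, y) = P(u, y + σy)` — so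
against `y` whose norm `y + σy` is not killed by `P(u, ·)` the value is non-zero: the blindness of §2 is a property of EIGEN `y`
(Kolyvagin classes), not of the pairing. [folklore] -/
theorem pairing_norm_eq_pairing_norm (u : A) (y : B) : P (u + τ u) y = P u (y + σ y) := by
  rw [map_add, AddMonoidHom.add_apply, pairing_tau_left_of_invariant τ σ hσ P hinv, map_add]

end Invisible

end Summit.BirchSwinnertonDyer.BirchSwinnertonDyer.Theorems.GenusExact.PlusDescent
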